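import Mathlib.NumberTheory.NumberField.Completion.FinitePlace
import Literature.NumberTheory.GaloisRepresentations.AdicCompletionUniformizer
import Literature.NumberTheory.EllipticCurves.TateCurve.UniformizationProofs
import Literature.NumberTheory.EllipticCurves.TateCurve.TateParameter
import Literature.NumberTheory.DiophantineGeometry.LocalReduction
import HarnessLib

/-!
# The Tate-curve API at a finite place of a number field (adapter for [IUTchI] Def. 3.1 /
# [IUTchIV] Thm. 1.10: "the `q`-parameter `q_v` of `E_F` at `v ∈ 𝕍^bad`")

Topic `Literature/NumberTheory/EllipticCurves/TateCurve`, namespace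
`Literature.NumberTheory.EllipticCurves.TateCurve` (abc-iut cell, TRANCHE-T1 P21). The local
theory of `Invariants` / `Uniformization` / `UniformizationProofs` is stated for an abstract
complete ultrametric field `K` of characteristic `0` with ring of integers `R` presented by
`‖x‖ ≤ 1 ↔ x ∈ R`. This file instantiates it at the COMPLETION `F_v = v.adicCompletion F` of a
number field `F` at a finite place `v`, with `R = v.adicCompletionIntegers F` and Mathlib's
`Valued`-induced norm (made a `NontriviallyNormedField` by the tree's local instance
`Literature.NumberTheory.GaloisRepresentations.Ultrametric.AdicCompletion.nontriviallyNormedField`,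
definitionally the registered `NormedField`):

* `norm_le_one_iff_mem_range_adicCompletionIntegers` — the presentation `‖x‖ ≤ 1 ↔ x ∈ 𝒪_v`;
* `charZero_adicCompletion'` — `F_v` has characteristic `0`;
* **`exists_tateParameter_adicCompletion`** — for an elliptic curve `E/F_v` some `F_v`-model of
  which is a minimal equation with split multiplicative reduction (Mathlib
  `HasSplitMultiplicativeReduction (v.adicCompletionIntegers F)`), there is `q_v ∈ F_v` with
  `q_v ≠ 0`, `‖q_v‖ < 1`, `tateJ q_v = j(E)`, `‖q_v‖ = ‖j(E)‖⁻¹` and a change of variables over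
  `F_v` carrying `E` to `tateCurve q_v` — UNCONDITIONAL (Silverman ATAEC V.5.3 + AEC VII.5.1 (b),
  all discharged in `UniformizationProofs.lean`);
* `tateParameter_adicCompletion_spec` — the same `q_v` is the tree's term `tateParameter E hj`
  (`TateCurve/TateParameter.lean`).
* **`exists_tateParameter_of_hasSplitMultiplicativeReductionAt`** — the GLOBAL-TO-LOCAL form the
  abc-iut consumers quantify over: `W` an elliptic curve over the number field `F` with the tree's
  `W.HasSplitMultiplicativeReductionAt v` (`Literature/NumberTheory/DiophantineGeometry/LocalReduction`,
  = Mathlib's class for the chosen local minimal model) ⇒ `W ⊗ F_v ≅_{F_v} tateCurve q_v` with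
  `tateJ q_v = j(W)`, `‖q_v‖_v = ‖j(W)‖_v⁻¹ < 1`. Same hypotheses as the tree's named fact
  `Silverman1994_thmV53_tateUniformisation` (which additionally asserts the analytic map `Φ`).

## References
* [SilvermanATAEC1994] J. H. Silverman, *Advanced Topics in the Arithmetic of Elliptic Curves*,
  GTM 151, Springer 1994, Thm. V.5.3 (PDF pp. 407–409) ("`K` a `p`-adic field").
-/

noncomputable section

open scoped Classical

open NumberField IsDedekindDomain WeierstrassCurve

namespace Literature.NumberTheory.EllipticCurves.TateCurve

open SteinWuthrich2013

variable (F : Type) [Field F] [NumberField F] (v : HeightOneSpectrum (𝓞 F))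

attribute [local instance]
  Literature.NumberTheory.GaloisRepresentations.Ultrametric.AdicCompletion.nontriviallyNormedField

/-- The ring of integers `𝒪_v = v.adicCompletionIntegers F` of `F_v` is the closed unit ball:
`‖x‖ ≤ 1 ↔ x ∈ 𝒪_v` (Mathlib `mem_adicCompletionIntegers` : `x ∈ 𝒪_v ↔ v(x) ≤ 1`, and
`Valued.toNormedField.norm_le_one_iff`). [cite: SilvermanATAEC1994, Thm. V.5.3 (PDF p. 407)] -/
theorem norm_le_one_iff_mem_range_adicCompletionIntegers (x : v.adicCompletion F) :
    ‖x‖ ≤ 1 ↔ x ∈ Set.range (algebraMap (v.adicCompletionIntegers F) (v.adicCompletion F)) := by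
  rw [Valued.toNormedField.norm_le_one_iff]
  constructor
  · intro h
    exact ⟨⟨x, (HeightOneSpectrum.mem_adicCompletionIntegers (𝓞 F) F v).mpr h⟩, rfl⟩
  · rintro ⟨r, rfl⟩
    exact (HeightOneSpectrum.mem_adicCompletionIntegers (𝓞 F) F v).mp r.2

/-- `F_v` has characteristic `0` (it contains the number field `F`).
[cite: SilvermanATAEC1994, Thm. V.5.3 (PDF p. 407)] -/
theorem charZero_adicCompletion' : CharZero (v.adicCompletion F) :=
  charZero_of_injective_algebraMap (algebraMap F (v.adicCompletion F)).injective

/-- **The Tate parameter at a finite place of a number field — UNCONDITIONAL** (Silverman ATAEC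
Thm. V.5.3 with AEC VII.5.1 (b), instantiated at `K = F_v`, `R = 𝒪_v`): an elliptic curve `E`
over `F_v` some `F_v`-model of which is a minimal Weierstrass equation with split multiplicative
reduction is `F_v`-isomorphic to the Tate curve `tateCurve q` for a `q ∈ F_v` with `q ≠ 0`,
`‖q‖ < 1`, `tateJ q = j(E)` and `‖q‖ = ‖j(E)‖⁻¹` (i.e. `ord_v q = -ord_v j(E)`, the clause of
[IUTchIV] Thm. 1.10). [cite: SilvermanATAEC1994, Thm. V.5.3 (PDF pp. 407–409)] -/
theorem exists_tateParameter_adicCompletion (E : WeierstrassCurve (v.adicCompletion F))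
    [E.IsElliptic]
    (hsplit : ∃ C : VariableChange (v.adicCompletion F),
      HasSplitMultiplicativeReduction (v.adicCompletionIntegers F) (C • E)) :
    ∃ q : v.adicCompletion F, q ≠ 0 ∧ ‖q‖ < 1 ∧ tateJ q = E.j ∧ ‖q‖ = ‖E.j‖⁻¹ ∧
      ∃ C : VariableChange (v.adicCompletion F), C • E = tateCurve q := by
  haveI := charZero_adicCompletion' F v
  exact exists_tateParameter_of_hasSplitMultiplicativeReduction' (v.adicCompletionIntegers F)
    (norm_le_one_iff_mem_range_adicCompletionIntegers F v) E hsplit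

/-- **Tate parameter of an elliptic curve over a number field at a place of split multiplicative
reduction — UNCONDITIONAL** (Silverman ATAEC V.5.3 at `K = F_v`): for `W/F` elliptic with the
tree's `W.HasSplitMultiplicativeReductionAt v` (the chosen local minimal model over `𝒪_v` has
split multiplicative reduction in Mathlib's sense), there is `q_v ∈ F_v` with `q_v ≠ 0`,
`‖q_v‖ < 1`, `tateJ q_v = j(W)` (in `F_v`), `‖q_v‖ = ‖j(W)‖_v⁻¹`, and a change of variables over
`F_v` carrying `W ⊗ F_v` to `tateCurve q_v`. This is the `q_v` of [IUTchI] Def. 3.1 and of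
"`ord_v(q_v)`" in [IUTchIV] Thm. 1.10. [cite: SilvermanATAEC1994, Thm. V.5.3 (PDF pp. 407–409)] -/
theorem exists_tateParameter_of_hasSplitMultiplicativeReductionAt (W : WeierstrassCurve F)
    [W.IsElliptic] (h : W.HasSplitMultiplicativeReductionAt v) :
    ∃ q : v.adicCompletion F, q ≠ 0 ∧ ‖q‖ < 1 ∧
      tateJ q = algebraMap F (v.adicCompletion F) W.j ∧
      ‖q‖ = ‖algebraMap F (v.adicCompletion F) W.j‖⁻¹ ∧
      ∃ C : VariableChange (v.adicCompletion F),
        C • W.baseChange (v.adicCompletion F) = tateCurve q := by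
  have hsplit : ∃ C : VariableChange (v.adicCompletion F),
      HasSplitMultiplicativeReduction (v.adicCompletionIntegers F)
        (C • W.baseChange (v.adicCompletion F)) := ⟨_, h⟩
  have hj : (W.baseChange (v.adicCompletion F)).j = algebraMap F (v.adicCompletion F) W.j :=
    W.map_j _
  obtain ⟨q, hq0, hq, hqj, hqn, hC⟩ :=
    exists_tateParameter_adicCompletion F v (W.baseChange (v.adicCompletion F)) hsplit
  rw [hj] at hqj hqn
  exact ⟨q, hq0, hq, hqj, hqn, hC⟩

/-- At a place of split multiplicative reduction `|j(E)|_v > 1`, so the TERM `tateParameter E hj`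
(`TateCurve/TateParameter.lean`) is available, and it is the `q` of
`exists_tateParameter_adicCompletion`: `E ≅_{F_v} tateCurve (tateParameter E hj)`.
[cite: SilvermanATAEC1994, Thm. V.5.3 (PDF pp. 407–409)] -/
theorem tateParameter_adicCompletion_spec (E : WeierstrassCurve (v.adicCompletion F))
    [E.IsElliptic]
    (hsplit : ∃ C : VariableChange (v.adicCompletion F),
      HasSplitMultiplicativeReduction (v.adicCompletionIntegers F) (C • E)) :
    ∃ hj : 1 < ‖E.j‖, ∃ C : VariableChange (v.adicCompletion F),
      C • E = tateCurve (tateParameter E hj) := by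
  obtain ⟨q, hq0, hq, hqj, hqn, C, hC⟩ := exists_tateParameter_adicCompletion F v E hsplit
  have hj : 1 < ‖E.j‖ := by
    rw [← hqj, norm_tateJ_eq hq]
    exact one_lt_inv_iff₀.mpr ⟨norm_pos_iff.mpr hq0, hq⟩
  refine ⟨hj, C, ?_⟩
  rw [hC, ← (eq_tateParameter_iff E hj q).mpr ⟨hq0, hq, hqj⟩]

/-- Norm and valuation on `F_v` determine each other (`‖x‖ = N(v)^{-ord_v x}`, Mathlib
`Valued.toNormedField.norm_le_iff`): `‖q‖ = ‖j‖⁻¹` is `v(q) = v(j)⁻¹`, i.e.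
**`ord_v(q_v) = -ord_v(j)`** in the additive normalisation used by [IUTchIV] Thm. 1.10 and by the
tree's `Literature/IUT/LogVolume` (`ord v x = -log (v.valuation F x)`).
[cite: SilvermanATAEC1994, Thm. V.5.3 (PDF pp. 407–409)] -/
theorem valuation_eq_inv_of_norm_eq_inv {q j : v.adicCompletion F}
    (h : ‖q‖ = ‖j‖⁻¹) : Valued.v q = (Valued.v j)⁻¹ := by
  rw [← norm_inv] at h
  rw [← map_inv₀]
  have h1 : Valued.v q ≤ Valued.v j⁻¹ := Valued.toNormedField.norm_le_iff.mp h.le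
  have h2 : Valued.v j⁻¹ ≤ Valued.v q := Valued.toNormedField.norm_le_iff.mp h.ge
  exact le_antisymm h1 h2

/-- **`v(q_v) = v(j(W))⁻¹` (`ord_v q_v = -ord_v j`) for the Tate parameter at a place of split
multiplicative reduction** — the valuation form of `exists_tateParameter_of_hasSplitMultiplicativeReductionAt`,
matching the "local height `h_v` = order of the `q`-parameter" of [GenEll] Def. 3.3 / [IUTchIV]
p. 44 as recorded in `Literature/IUT/LogVolume/Corollary22Statement.lean` (`localHeight`).
[cite: SilvermanATAEC1994, Thm. V.5.3 (PDF pp. 407–409)] -/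
theorem exists_tateParameter_valuation_of_hasSplitMultiplicativeReductionAt (W : WeierstrassCurve F)
    [W.IsElliptic] (h : W.HasSplitMultiplicativeReductionAt v) :
    ∃ q : v.adicCompletion F, q ≠ 0 ∧ Valued.v q < 1 ∧
      tateJ q = algebraMap F (v.adicCompletion F) W.j ∧
      Valued.v q = (Valued.v (algebraMap F (v.adicCompletion F) W.j))⁻¹ ∧
      ∃ C : VariableChange (v.adicCompletion F),
        C • W.baseChange (v.adicCompletion F) = tateCurve q := by
  obtain ⟨q, hq0, hq, hqj, hqn, hC⟩ := exists_tateParameter_of_hasSplitMultiplicativeReductionAt F v W h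
  exact ⟨q, hq0, Valued.toNormedField.norm_lt_one_iff.mp hq, hqj,
    valuation_eq_inv_of_norm_eq_inv F v hqn, hC⟩

end Literature.NumberTheory.EllipticCurves.TateCurve

end
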